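import Summits.CriticalPhenomena.CardyFormulaZ2.Theses.CardyBoundaryCoulombGas
import Summits.CriticalPhenomena.CardyFormulaZ2.Theorems.CardyBoundaryCoulombGasStripClusterRatesRowDictionary
import Summits.CriticalPhenomena.CardyFormulaZ2.Theorems.CardyBoundaryCoulombGasStripClusterRatesSeqCounting
import Literature.Probability.LatticeModels.RowStatePlanar
import Literature.Probability.Percolation.LatticeSymmetry
import Literature.Probability.Percolation.PlanarDuality
import Literature.Probability.Percolation.RSW

/-!
# Stub D1 `stub_oneClusterDictionary` of the line `two-cluster-rate-is-stationary-gap`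
# (wired row-transfer dictionary, the crossing event through the chain, and the count)

Crux `CardyBoundaryCoulombGas.StripClusterRates` (stmt-CriticalPhenomena-13878), line
`two-cluster-rate-is-stationary-gap`, registered stub D1 (row-transfer exactness for the one-arc
readout): the left–right crossing probability `crossingProb half m n` of `[0,m]×[0,n]` under
critical bond percolation equals the fraction of admissible bond sequences
`seq : Fin m → Finset S × Finset S` (`seq t ∈ univ ×ˢ (hEdges S).powerset`, `S = Finset.Icc 0 n`)
whose iterate `(List.ofFn seq).foldl planarRowStep (PlanarRowState.wired S)` has some site joined
to `⋆` — `p₁(m,n) = δ_wired · T^m · (one-arc readout)` for the planar `⋆`-chain `planarTransfer S`,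
in counting form.

Conventions (all inline, no definitions; companions `…StripClusterRatesRowDictionary.lean` — the
general-start dictionary `d1_foldl_rowStep_rel_iff` — and `…StripClusterRatesSeqCounting.lean` —
the counting formula `d1_bondPercolation_half_real_seqOf_mem`): chain time is the `x`-coordinate,
the configuration `ω` is read column by column as `seqOf ω m = fun t : Fin m => (O_t, H_t)`,
`O_t = {y : {(t,y),(t+1,y)} ∈ ω}`, `H_t = {y : y+1 ≤ n, {(t+1,y),(t+1,y+1)} ∈ ω}`; the WIRED
configuration is `ω⁺ = ω ∪ {{(0,y),(0,y+1)} : 0 ≤ y < n}` (column `0` wired), `⋆ ↦ (0,0)`.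

* `d1_iter_seqOf_wired_rel_iff` — for a lattice configuration `ω ⊆ E(ℤ²)`, two row points are
  joined in the `m`-th iterate of `rowStep` from `RowState.wired S` driven by `seqOf ω m` iff their
  avatars (`inl y ↦ (m,y)`, `⋆ ↦ (0,0)`) are joined by an `ω⁺`-open path inside `rectangle m n`;
  `d1_iter_seqOf_wired_rel_inl_iff`, `d1_iter_seqOf_wired_joinedToStar_iff` — the two readable
  specialisations; `d1_foldl_planarRowStep_val` — the same iterate on `PlanarRowState` has this
  underlying state; `d1_wired_column_conn`, `d1_wired_subset_edgeSet`, `d1_mem_wired_iff` —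
  bookkeeping for `ω⁺`.
* `d1_lrCrossing_iff_exists_joinedToStar` — `ω` has an open left–right crossing of `rectangle m n`
  iff some site of column `m` is joined to `⋆` in that iterate (cut an `ω⁺`-open path to `(0,0)`
  at its first visit to column `0`).
* `stub_oneClusterDictionary` — THE STUB: a.s. `ω ⊆ E(ℤ²)` (`ae_subset_edgeSet`), so the crossing
  event is a.s. the one-arc readout of the wired iterate, an event read through the bond sequence,
  whose probability is the normalised count.

Sources: Bondesan–Jacobsen–Saleur, Nucl. Phys. B 867 (2013) §2, §5.1; Cardy,
arXiv:math-ph/0103018 §7.1 (row-transfer exactness); Blöte–Nightingale (1982); folklore.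
-/

noncomputable section

namespace Summit.CriticalPhenomena.CardyFormulaZ2.Cruxes.StripClusterRates.TwoClusterRateIsStationaryGap

open Filter Topology MeasureTheory
open scoped BigOperators Classical
open Literature.Probability.Percolation Literature.Probability.LatticeModels

/-! ## The wired start: `ω⁺ = ω ∪ {column-0 vertical edges}`, `⋆ = (0,0)` -/

/-- Inside column `0`, the wired configuration `ω⁺` joins `(0,0)` to every `(0,k)`, `k ≤ n`.
[folklore] -/
theorem d1_wired_column_conn (n : ℕ) (ω : BondConfig (Site 2)) (k : ℕ) (hk : k ≤ n) :
    (ω ∪ {e | ∃ y : ℤ, 0 ≤ y ∧ y + 1 ≤ n ∧ e = s(![0, y], ![0, y + 1])}) ∈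
      openConnIn (rectangle 0 n : Set (Site 2)) ![0, 0] ![0, (k : ℤ)] := by
  induction k with
  | zero =>
    refine openConnIn_refl ?_
    rw [d1_vec_mem_rectangle]
    omega
  | succ k ih =>
    refine PlanarDuality.openConnIn_trans (ih (Nat.le_of_succ_le hk)) (openConnIn_of_adj ?_ ?_ ?_ ?_)
    · rw [d1_vec_mem_rectangle]; omega
    · rw [d1_vec_mem_rectangle]; omega
    · refine Or.inr ⟨k, by omega, by omega, ?_⟩
      push_cast
      rfl
    · rw [Ne, Site.eq_iff_two]; simp

/-- The wired configuration of a lattice configuration is a lattice configuration. [folklore] -/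
theorem d1_wired_subset_edgeSet (n : ℕ) {ω : BondConfig (Site 2)} (hω : ω ⊆ (zdGraph 2).edgeSet) :
    (ω ∪ {e | ∃ y : ℤ, 0 ≤ y ∧ y + 1 ≤ n ∧ e = s(![0, y], ![0, y + 1])}) ⊆ (zdGraph 2).edgeSet := by
  rintro e (he | ⟨y, -, -, rfl⟩)
  · exact hω he
  · rw [SimpleGraph.mem_edgeSet, zdGraph_two_adj_iff]
    simp

/-- An edge with an endpoint off column `0` is open in `ω⁺` iff it is open in `ω`. [folklore] -/
theorem d1_mem_wired_iff (n : ℕ) (ω : BondConfig (Site 2)) {i j i' j' : ℤ} (h : i' ≠ 0) :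
    s(![i, j], ![i', j']) ∈ (ω ∪ {e | ∃ y : ℤ, 0 ≤ y ∧ y + 1 ≤ n ∧ e = s(![0, y], ![0, y + 1])}) ↔
      s(![i, j], ![i', j']) ∈ ω := by
  refine ⟨?_, fun he => Or.inl he⟩
  rintro (he | ⟨y, -, -, he⟩)
  · exact he
  · exfalso
    simp only [Sym2.eq_iff, Site.eq_iff_two, Matrix.cons_val_zero, Matrix.cons_val_one,
      Matrix.cons_val_fin_one] at he
    omega

/-- **The wired dictionary.** Drive the chain from the WIRED state with the bonds of a lattice
configuration `ω` read column by column (`O_t = {y : {(t,y),(t+1,y)} ∈ ω}`,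
`H_t = {y : y+1 ≤ n, {(t+1,y),(t+1,y+1)} ∈ ω}`, time `0` first). Then two row points are joined in
the `m`-th iterate iff their avatars (`inl y ↦ (m,y)`, `⋆ ↦ (0,0)`) are joined inside
`rectangle m n` by an open path of `ω⁺ = ω ∪ {column-0 vertical edges}` (column `0` is wired).
[folklore] -/
theorem d1_iter_seqOf_wired_rel_iff (n m : ℕ) {ω : BondConfig (Site 2)}
    (hω : ω ⊆ (zdGraph 2).edgeSet) (a b : RowPoint (Finset.Icc (0 : ℤ) n)) :
    ((List.ofFn fun t : Fin m =>
        ((Finset.univ.filter fun y : Finset.Icc (0 : ℤ) n =>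
            s(![((t : ℕ) : ℤ), (y : ℤ)], ![((t : ℕ) : ℤ) + 1, (y : ℤ)]) ∈ ω),
          (Finset.univ.filter fun y : Finset.Icc (0 : ℤ) n =>
            (y : ℤ) + 1 ∈ Finset.Icc (0 : ℤ) n ∧
              s(![((t : ℕ) : ℤ) + 1, (y : ℤ)], ![((t : ℕ) : ℤ) + 1, (y : ℤ) + 1]) ∈ ω))).foldl
      (fun r OH => rowStep OH.1 OH.2 r) (RowState.wired (Finset.Icc (0 : ℤ) n))).rel a b ↔
    (ω ∪ {e | ∃ y : ℤ, 0 ≤ y ∧ y + 1 ≤ n ∧ e = s(![0, y], ![0, y + 1])}) ∈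
      openConnIn (rectangle m n : Set (Site 2))
        (Sum.elim (fun y : Finset.Icc (0 : ℤ) n => ![(m : ℤ), (y : ℤ)]) (fun _ => ![0, 0]) a)
        (Sum.elim (fun y : Finset.Icc (0 : ℤ) n => ![(m : ℤ), (y : ℤ)]) (fun _ => ![0, 0]) b) := by
  have hyS : ∀ y : Finset.Icc (0 : ℤ) n, 0 ≤ (y : ℤ) ∧ (y : ℤ) ≤ n := fun y => Finset.mem_Icc.1 y.2
  set ωp := ω ∪ {e | ∃ y : ℤ, 0 ≤ y ∧ y + 1 ≤ n ∧ e = s(![0, y], ![0, y + 1])} with hωp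
  -- column `0` is wired: every avatar is joined to `(0,0)` inside `rectangle 0 n`
  have hcol : ∀ c : RowPoint (Finset.Icc (0 : ℤ) n), ωp ∈ openConnIn (rectangle 0 n : Set (Site 2))
      ![0, 0] (Sum.elim (fun y : Finset.Icc (0 : ℤ) n => ![0, (y : ℤ)]) (fun _ => ![0, 0]) c) := by
    rintro (y | u)
    · obtain ⟨k, hk⟩ := Int.eq_ofNat_of_zero_le (hyS y).1
      simp only [Sum.elim_inl]
      rw [hk]
      have := hyS y
      exact d1_wired_column_conn n ω k (by omega)
    · refine openConnIn_refl ?_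
      simp only [d1_vec_mem_rectangle, Nat.cast_zero]
      omega
  have key := d1_foldl_rowStep_rel_iff n ωp (d1_wired_subset_edgeSet n hω)
    (fun t => Finset.univ.filter fun y : Finset.Icc (0 : ℤ) n =>
      s(![(t : ℤ), (y : ℤ)], ![(t : ℤ) + 1, (y : ℤ)]) ∈ ω)
    (fun t => Finset.univ.filter fun y : Finset.Icc (0 : ℤ) n =>
      (y : ℤ) + 1 ∈ Finset.Icc (0 : ℤ) n ∧ s(![(t : ℤ) + 1, (y : ℤ)], ![(t : ℤ) + 1, (y : ℤ) + 1]) ∈ ω)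
    (fun t y => by
      rw [Finset.mem_filter, hωp, d1_mem_wired_iff n ω (by omega)]
      simp)
    (fun t y hy => by
      rw [Finset.mem_filter, hωp, d1_mem_wired_iff n ω (by omega)]
      simp [hy])
    ![0, 0] (by simp) (RowState.wired (Finset.Icc (0 : ℤ) n))
    (fun c d => iff_of_true trivial (Or.inr
      (PlanarDuality.openConnIn_trans (by rw [openConnIn_comm]; exact hcol c) (hcol d))))
    m a b
  refine key.trans ⟨?_, Or.inr⟩
  rintro (rfl | h)
  · refine openConnIn_refl ?_
    rcases a with y | u
    · have := hyS y
      simp only [Sum.elim_inl, d1_vec_mem_rectangle]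
      omega
    · simp only [Sum.elim_inr, d1_vec_mem_rectangle]
      omega
  · exact h

/-- **Wired dictionary, two sites**: `y`, `y'` are joined in the `m`-th wired iterate iff
`(m,y)` and `(m,y')` are joined inside `rectangle m n` by an `ω⁺`-open path. [folklore] -/
theorem d1_iter_seqOf_wired_rel_inl_iff (n m : ℕ) {ω : BondConfig (Site 2)}
    (hω : ω ⊆ (zdGraph 2).edgeSet) (y y' : Finset.Icc (0 : ℤ) n) :
    ((List.ofFn fun t : Fin m =>
        ((Finset.univ.filter fun y : Finset.Icc (0 : ℤ) n =>
            s(![((t : ℕ) : ℤ), (y : ℤ)], ![((t : ℕ) : ℤ) + 1, (y : ℤ)]) ∈ ω),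
          (Finset.univ.filter fun y : Finset.Icc (0 : ℤ) n =>
            (y : ℤ) + 1 ∈ Finset.Icc (0 : ℤ) n ∧
              s(![((t : ℕ) : ℤ) + 1, (y : ℤ)], ![((t : ℕ) : ℤ) + 1, (y : ℤ) + 1]) ∈ ω))).foldl
      (fun r OH => rowStep OH.1 OH.2 r) (RowState.wired (Finset.Icc (0 : ℤ) n))).rel
        (Sum.inl y) (Sum.inl y') ↔
    (ω ∪ {e | ∃ y : ℤ, 0 ≤ y ∧ y + 1 ≤ n ∧ e = s(![0, y], ![0, y + 1])}) ∈
      openConnIn (rectangle m n : Set (Site 2)) ![(m : ℤ), (y : ℤ)] ![(m : ℤ), (y' : ℤ)] :=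
  d1_iter_seqOf_wired_rel_iff n m hω (Sum.inl y) (Sum.inl y')

/-- **Wired dictionary, one-arc readout**: the site `y` is joined to `⋆` in the `m`-th wired
iterate iff `(m,y)` is joined to `(0,0)` (i.e. to the wired column `0`) inside `rectangle m n` by
an `ω⁺`-open path. [folklore] -/
theorem d1_iter_seqOf_wired_joinedToStar_iff (n m : ℕ) {ω : BondConfig (Site 2)}
    (hω : ω ⊆ (zdGraph 2).edgeSet) (y : Finset.Icc (0 : ℤ) n) :
    ((List.ofFn fun t : Fin m =>
        ((Finset.univ.filter fun y : Finset.Icc (0 : ℤ) n =>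
            s(![((t : ℕ) : ℤ), (y : ℤ)], ![((t : ℕ) : ℤ) + 1, (y : ℤ)]) ∈ ω),
          (Finset.univ.filter fun y : Finset.Icc (0 : ℤ) n =>
            (y : ℤ) + 1 ∈ Finset.Icc (0 : ℤ) n ∧
              s(![((t : ℕ) : ℤ) + 1, (y : ℤ)], ![((t : ℕ) : ℤ) + 1, (y : ℤ) + 1]) ∈ ω))).foldl
      (fun r OH => rowStep OH.1 OH.2 r) (RowState.wired (Finset.Icc (0 : ℤ) n))).JoinedToStar y ↔
    (ω ∪ {e | ∃ y : ℤ, 0 ≤ y ∧ y + 1 ≤ n ∧ e = s(![0, y], ![0, y + 1])}) ∈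
      openConnIn (rectangle m n : Set (Site 2)) ![(m : ℤ), (y : ℤ)] ![0, 0] :=
  d1_iter_seqOf_wired_rel_iff n m hω (Sum.inl y) (Sum.inr ())

/-- Planar bookkeeping: iterating `planarRowStep` is iterating `rowStep` on the underlying states
(`(planarRowStep O H p).1 = rowStep O H p.1` definitionally). [folklore] -/
theorem d1_foldl_planarRowStep_val {S : Finset ℤ} (l : List (Finset S × Finset S))
    (p : PlanarRowState S) :
    (l.foldl (fun r OH => planarRowStep OH.1 OH.2 r) p).1 =
      l.foldl (fun r OH => rowStep OH.1 OH.2 r) p.1 := by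
  induction l generalizing p with
  | nil => rfl
  | cons x l ih => exact ih _

/-! ## The left–right crossing event through the chain -/

/-- **The one-arc readout is the left–right crossing.** For a lattice configuration `ω`, the
rectangle `[0,m]×[0,n]` has an open left–right crossing iff some site of column `m` is joined to
`⋆` in the `m`-th wired iterate (an `ω⁺`-open path from `(m,y)` to `(0,0)`, cut at its first visit
to column `0`, is an `ω`-open path to the left side). [folklore] -/
theorem d1_lrCrossing_iff_exists_joinedToStar (n m : ℕ) {ω : BondConfig (Site 2)}
    (hω : ω ⊆ (zdGraph 2).edgeSet) :
    ω ∈ lrCrossing m n ↔ ∃ y : Finset.Icc (0 : ℤ) n,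
      ((List.ofFn fun t : Fin m =>
        ((Finset.univ.filter fun y : Finset.Icc (0 : ℤ) n =>
            s(![((t : ℕ) : ℤ), (y : ℤ)], ![((t : ℕ) : ℤ) + 1, (y : ℤ)]) ∈ ω),
          (Finset.univ.filter fun y : Finset.Icc (0 : ℤ) n =>
            (y : ℤ) + 1 ∈ Finset.Icc (0 : ℤ) n ∧
              s(![((t : ℕ) : ℤ) + 1, (y : ℤ)], ![((t : ℕ) : ℤ) + 1, (y : ℤ) + 1]) ∈ ω))).foldl
      (fun r OH => rowStep OH.1 OH.2 r) (RowState.wired (Finset.Icc (0 : ℤ) n))).JoinedToStar y := by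
  set ωp := ω ∪ {e | ∃ y : ℤ, 0 ≤ y ∧ y + 1 ≤ n ∧ e = s(![0, y], ![0, y + 1])} with hωp
  have hrect : (rectangle 0 n : Set (Site 2)) ⊆ (rectangle m n : Set (Site 2)) :=
    Finset.coe_subset.2 (rectangle_mono (Nat.zero_le m) le_rfl)
  constructor
  · rintro ⟨x, hx, z, hz, hxz⟩
    have hx' := Finset.mem_filter.1 (Finset.mem_coe.1 hx)
    have hz' := Finset.mem_filter.1 (Finset.mem_coe.1 hz)
    have hxr := mem_rectangle_iff.1 hx'.1
    have hzr := mem_rectangle_iff.1 hz'.1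
    refine ⟨⟨z 1, Finset.mem_Icc.2 ⟨hzr.2.2.1, hzr.2.2.2⟩⟩, ?_⟩
    rw [d1_iter_seqOf_wired_joinedToStar_iff n m hω]
    have hzeq : z = ![(m : ℤ), z 1] := by rw [Site.eq_iff_two]; simp [hz'.2]
    have hxeq : x = ![0, x 1] := by rw [Site.eq_iff_two]; simp [hx'.2]
    have h1 : ωp ∈ openConnIn (rectangle m n : Set (Site 2)) x z :=
      isUpperSet_openConnIn _ _ _ Set.subset_union_left hxz
    obtain ⟨k, hk⟩ := Int.eq_ofNat_of_zero_le hxr.2.2.1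
    have h2 : ωp ∈ openConnIn (rectangle m n : Set (Site 2)) ![0, 0] x := by
      rw [hxeq, hk]
      exact openConnIn_mono hrect _ _ (d1_wired_column_conn n ω k (by omega))
    have h3 := PlanarDuality.openConnIn_trans h2 h1
    rw [openConnIn_comm, hzeq] at h3
    exact h3
  · rintro ⟨y, hy⟩
    rw [d1_iter_seqOf_wired_joinedToStar_iff n m hω] at hy
    obtain ⟨P, hPs, hPe⟩ := exists_walk_of_mem_openConnIn (d1_wired_subset_edgeSet n hω) hy
    -- cut an `ω⁺`-open walk at its first visit to column `0`
    have key : ∀ {u v : Site 2} (W : (zdGraph 2).Walk u v),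
        (∀ z ∈ W.support, z ∈ (rectangle m n : Set (Site 2))) → (∀ e ∈ W.edges, e ∈ ωp) →
        v 0 = 0 → ∃ x ∈ (leftSide m n : Set (Site 2)), ω ∈ openConnIn (rectangle m n : Set (Site 2)) u x := by
      intro u v W
      induction W with
      | @nil u =>
        intro hs _ hv0
        exact ⟨u, Finset.mem_coe.2 (Finset.mem_filter.2 ⟨Finset.mem_coe.1 (hs u (by simp)), hv0⟩),
          openConnIn_refl (hs u (by simp))⟩
      | @cons u w v hadj W ih =>
        intro hs he hv0
        by_cases hu0 : u 0 = 0
        · exact ⟨u, Finset.mem_coe.2 (Finset.mem_filter.2 ⟨Finset.mem_coe.1 (hs u (by simp)), hu0⟩),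
            openConnIn_refl (hs u (by simp))⟩
        obtain ⟨x, hx, hwx⟩ := ih (fun z hz => hs z (by simp [hz])) (fun e he' => he e (by simp [he'])) hv0
        have huw : s(u, w) ∈ ωp := he _ (by simp)
        rcases huw with huw | ⟨y', -, -, hyeq⟩
        · exact ⟨x, hx, PlanarDuality.openConnIn_trans
            (openConnIn_of_adj (hs u (by simp)) (hs w (by simp)) huw hadj.ne) hwx⟩
        · exfalso
          rw [Sym2.eq_iff] at hyeq
          rcases hyeq with ⟨hu, -⟩ | ⟨hu, -⟩ <;> (rw [hu] at hu0; simp at hu0)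
    obtain ⟨x, hx, hconn⟩ := key P hPs hPe (by simp)
    refine ⟨x, hx, ![(m : ℤ), (y : ℤ)], ?_, by rw [openConnIn_comm]; exact hconn⟩
    have := Finset.mem_Icc.1 y.2
    refine Finset.mem_coe.2 (Finset.mem_filter.2 ⟨?_, by simp⟩)
    rw [← Finset.mem_coe, d1_vec_mem_rectangle]
    omega

/-! ## The registered stub D1 -/

/-- **D1 · ONE-CLUSTER DICTIONARY** (row-transfer exactness for the one-arc readout): the
left–right crossing probability of `[0,m]×[0,n]` at `p = 1/2` is the fraction of admissible bond
sequences whose iterate from the WIRED planar state has some site joined to `⋆`. Proof: a.s.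
`ω ⊆ E(ℤ²)` (`ae_subset_edgeSet`); for such `ω` the crossing event is the one-arc readout of the
wired iterate driven by `ω` (`d1_lrCrossing_iff_exists_joinedToStar`, the pathwise dictionary), an
event read through the bond sequence, whose probability is the normalised count
(`d1_bondPercolation_half_real_seqOf_mem`). [folklore] -/
theorem stub_oneClusterDictionary :
    ∀ m n : ℕ, crossingProb half m n =
      ((((Fintype.piFinset fun _ : Fin m =>
            (Finset.univ : Finset (Finset (Finset.Icc (0 : ℤ) n))) ×ˢ (hEdges (Finset.Icc (0 : ℤ) n)).powerset).filter
          fun seq => ∃ x, ((List.ofFn seq).foldl (fun r OH => planarRowStep OH.1 OH.2 r)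
            (PlanarRowState.wired (Finset.Icc (0 : ℤ) n))).1.JoinedToStar x).card : ℝ) /
        ((2 : ℝ) ^ (Finset.Icc (0 : ℤ) n).card * 2 ^ (hEdges (Finset.Icc (0 : ℤ) n)).card) ^ m) := by
  intro m n
  -- the marked sequences
  set A : Set (Fin m → Finset (Finset.Icc (0 : ℤ) n) × Finset (Finset.Icc (0 : ℤ) n)) :=
    {seq | ∃ x, ((List.ofFn seq).foldl (fun r OH => planarRowStep OH.1 OH.2 r)
      (PlanarRowState.wired (Finset.Icc (0 : ℤ) n))).1.JoinedToStar x} with hA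
  have hcount := d1_bondPercolation_half_real_seqOf_mem n m A
  -- the crossing event is, almost surely, the one-arc readout of the wired iterate
  have hae : lrCrossing m n =ᵐ[bondPercolation (zdGraph 2) half]
      {ω : BondConfig (Site 2) | (fun t : Fin m =>
        ((Finset.univ.filter fun y : Finset.Icc (0 : ℤ) n =>
            s(![((t : ℕ) : ℤ), (y : ℤ)], ![((t : ℕ) : ℤ) + 1, (y : ℤ)]) ∈ ω),
          (Finset.univ.filter fun y : Finset.Icc (0 : ℤ) n =>
            (y : ℤ) + 1 ∈ Finset.Icc (0 : ℤ) n ∧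
              s(![((t : ℕ) : ℤ) + 1, (y : ℤ)], ![((t : ℕ) : ℤ) + 1, (y : ℤ) + 1]) ∈ ω))) ∈ A} := by
    filter_upwards [ae_subset_edgeSet (zdGraph 2) half] with ω hω
    refine propext ?_
    show ω ∈ lrCrossing m n ↔ _ ∈ A
    rw [d1_lrCrossing_iff_exists_joinedToStar n m hω, hA, Set.mem_setOf_eq,
      d1_foldl_planarRowStep_val]
    rfl
  unfold crossingProb
  rw [measureReal_congr hae, hcount]
  congr 3
  exact @Finset.filter_congr _ _ _ (_) (_) _ fun seq _ => Iff.rfl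


end Summit.CriticalPhenomena.CardyFormulaZ2.Cruxes.StripClusterRates.TwoClusterRateIsStationaryGap
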